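import Summits.BirchSwinnertonDyer.BirchSwinnertonDyer.Theorems.BiquadraticEisensteinDescentHeegnerTwistCouplingInSupplyLinnikCensusKTwo
import HarnessLib

set_option linter.dupNamespace false -- `Summit.BirchSwinnertonDyer.BirchSwinnertonDyer.Theorems.…` (summit = sub)
set_option autoImplicit false

/-!
# Crux `HeegnerTwistCouplingInSupply` (stmt-BirchSwinnertonDyer-21381) — the pattern-free census at `k = 3`:
# scalar specialisation and the FIRST FOUR-prime congruent family `E_{105p}` (all but `O(log⁸Q)` primes `p ≡ 7 (8)`)

Route `BiquadraticEisensteinDescent` (cell `pub/bsd-wall`, width seat `bsd-wall-cm-bed-w3` g20; `--supports` 21381, helper). Companion of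
`…LinnikCensusK` (general `k`) and `…LinnikCensusKTwo` (`k = 2`). At `k = 3` the base is `p·r₁·r₂·r₃`; the general-`k` census
`kAny_allBut_odd_of_BT` is specialised to scalar data (`kThree_allBut_two_of_BT`), the eight sign patterns `((r₁/p),(r₂/p),(r₃/p))`
are assembled (`assemble_eight`, via `assemble_four`), and ONE pattern-free family (found by the w3 g20 solver; certified by `decide`
of `pfRecipeOdd` in each of the eight sub-configurations) serves `W = E_{105p}`: cells `(3 mod 8; (q/p) = (q/3) = (q/5) = +1,
(q/7) = −1)` and `(5 mod 8; (q/p) = (q/3) = −1, (q/5) = (q/7) = +1)`, unit slot classes `19, 29 (mod 840)`.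

* ★ `kThree_allBut_two_of_BT`, `assemble_eight`;
* ★ `cruxConclusion_E105p_allBut_of_BT` — for all but `O(log⁸ Q)` primes `p ≡ 7 (mod 8)` in `(√Q, Q]`: a Heegner field `K′` of
  `N(E_{105p})` with `4 < |d_{K′}|`, `L(E_{105p}^{(d_{K′})}, 1) ≠ 0`, `p ∤ h(K′)` — modulo Burungale–Tian ONLY.

HONEST FRAMING: RUNG-LEVEL, density one in `p` with a polylog exceptional set, one more congruent family; the crux as stated (all CM
`W`, all `p ≥ 5`; residual C⁺), its registered stubs and BSD are NOT touched; nothing is closed. THEOREMS ONLY.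
-/

namespace Summit.BirchSwinnertonDyer.BirchSwinnertonDyer.Theorems.LinnikCensus

open Finset
open Literature.NumberTheory.EllipticCurves
open Summit.BirchSwinnertonDyer.BirchSwinnertonDyer.Theorems.SymbolicMonsky

/-! ## The `k = 3`, two-slot specialisation with scalar parameters -/

open scoped Classical in
/-- ★ **k = 3, two slots, odd base `W = E_{p r₁ r₂ r₃}`** — `kAny_allBut_odd_of_BT` with scalar data: base classes `pc, rc₁, rc₂, rc₃`,
base symbols `a, b, c = [(r_j/p) = −1]`, `r12, r13, r23 = [(r_j/r_i) = −1]`; cells `(c₀, m₀), (c₁, m₁)` (bitmask `bit 0 = [(q/p) = −1]`,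
`bit j = [(q/r_j) = −1]`, passed also as Booleans `e…`); unit slot classes `κ₀, κ₁ (mod 8 r₁ r₂ r₃)`. Modulo Burungale–Tian ONLY.
[cite: BurungaleTian2026, Thm. 1.1] [cite: Montgomery1978, p. 561] [cite: MontgomeryVaughan2007, Cor. 11.17] -/
theorem kThree_allBut_two_of_BT (hBT : burungaleTian_analyticRank_eq_zero_of_selmerCorank_eq_zero_of_hasCM)
    (pc rc₁ rc₂ rc₃ : Fin 4) (r12 r13 r23 a b c : Bool) (c₀ c₁ : Fin 4) (m₀ m₁ : ℕ)
    (hpf : pfRecipeOdd (⟨![pc, rc₁, rc₂, rc₃], ![![false, a, b, c], ![false, false, r12, r13], ![false, false, false, r23],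
      ![false, false, false, false]]⟩ : SymbData 4) [(c₀, m₀), (c₁, m₁)] = true)
    (hdist : c₀ ≠ c₁ ∨ m₀.testBit 0 ≠ m₁.testBit 0 ∨ m₀.testBit 1 ≠ m₁.testBit 1 ∨ m₀.testBit 2 ≠ m₁.testBit 2 ∨
      m₀.testBit 3 ≠ m₁.testBit 3)
    {r₁ r₂ r₃ : ℕ} (hr₁ : r₁.Prime) (hr₂ : r₂.Prime) (hr₃ : r₃.Prime) (h12 : r₁ ≠ r₂) (h13 : r₁ ≠ r₃) (h23 : r₂ ≠ r₃)
    (hr₁m : r₁ % 8 = clsVal rc₁) (hr₂m : r₂ % 8 = clsVal rc₂) (hr₃m : r₃ % 8 = clsVal rc₃)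
    (hr12 : jacobiSym (r₂ : ℤ) r₁ = -1 ↔ r12 = true) (hr13 : jacobiSym (r₃ : ℤ) r₁ = -1 ↔ r13 = true)
    (hr23 : jacobiSym (r₃ : ℤ) r₂ = -1 ↔ r23 = true)
    (κ₀ κ₁ : ℕ) (hκ₀u : IsUnit ((κ₀ : ℕ) : ZMod (8 * (r₁ * r₂ * r₃)))) (hκ₁u : IsUnit ((κ₁ : ℕ) : ZMod (8 * (r₁ * r₂ * r₃))))
    (hκ₀m : κ₀ % 8 = clsVal c₀) (hκ₁m : κ₁ % 8 = clsVal c₁)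
    (e₀₁ e₀₂ e₀₃ e₁₁ e₁₂ e₁₃ : Bool) (hb₀₁ : m₀.testBit 1 = e₀₁) (hb₀₂ : m₀.testBit 2 = e₀₂) (hb₀₃ : m₀.testBit 3 = e₀₃)
    (hb₁₁ : m₁.testBit 1 = e₁₁) (hb₁₂ : m₁.testBit 2 = e₁₂) (hb₁₃ : m₁.testBit 3 = e₁₃)
    (hκ₀e : ∀ q : ℕ, q.Prime → q % (8 * (r₁ * r₂ * r₃)) = κ₀ % (8 * (r₁ * r₂ * r₃)) →
      (jacobiSym (q : ℤ) r₁ = -1 ↔ e₀₁ = true) ∧ (jacobiSym (q : ℤ) r₂ = -1 ↔ e₀₂ = true) ∧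
        (jacobiSym (q : ℤ) r₃ = -1 ↔ e₀₃ = true))
    (hκ₁e : ∀ q : ℕ, q.Prime → q % (8 * (r₁ * r₂ * r₃)) = κ₁ % (8 * (r₁ * r₂ * r₃)) →
      (jacobiSym (q : ℤ) r₁ = -1 ↔ e₁₁ = true) ∧ (jacobiSym (q : ℤ) r₂ = -1 ↔ e₁₂ = true) ∧
        (jacobiSym (q : ℤ) r₃ = -1 ↔ e₁₃ = true)) :
    ∃ C : ℝ, 0 < C ∧ ∀ Q : ℕ, 3 ≤ Q → ∃ E : Finset ℕ, (E.card : ℝ) ≤ C * Real.log Q ^ 8 ∧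
      ∀ p : ℕ, p.Prime → p % 8 = clsVal pc → (jacobiSym (r₁ : ℤ) p = -1 ↔ a = true) → (jacobiSym (r₂ : ℤ) p = -1 ↔ b = true) →
        (jacobiSym (r₃ : ℤ) p = -1 ↔ c = true) → Nat.sqrt Q < p → p ≤ Q → p ∉ E →
        ∃ (K : Type) (_ : Field K) (_ : NumberField K),
          IsImaginaryQuadratic K ∧ 4 < (NumberField.discr K).natAbs ∧
          SatisfiesHeegnerHypothesis ((congruentNumberCurve (p * (r₁ * r₂ * r₃))).conductorNorm ℤ) K ∧
          ((congruentNumberCurve (p * (r₁ * r₂ * r₃))).quadraticTwist (NumberField.discr K : ℚ)).entireLFunction 1 ≠ 0 ∧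
          ¬ p ∣ NumberField.classNumber K := by
  have hr : ∀ j : Fin 3, ((![r₁, r₂, r₃] : Fin 3 → ℕ) j).Prime := by
    intro j; fin_cases j
    · exact hr₁
    · exact hr₂
    · exact hr₃
  have hrinj : Function.Injective (![r₁, r₂, r₃] : Fin 3 → ℕ) := by
    intro i j h
    fin_cases i <;> fin_cases j
    · rfl
    · exact absurd h h12
    · exact absurd h h13
    · exact absurd h.symm h12
    · rfl
    · exact absurd h h23
    · exact absurd h.symm h13
    · exact absurd h.symm h23
    · rfl
  have hM : 8 * (r₁ * r₂ * r₃) = 8 * ∏ j, (![r₁, r₂, r₃] : Fin 3 → ℕ) j := by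
    simp [Fin.prod_univ_three, mul_assoc]
  have hprod : ∀ p : ℕ, p * ∏ j, (![r₁, r₂, r₃] : Fin 3 → ℕ) j = p * (r₁ * r₂ * r₃) := by
    intro p; simp [Fin.prod_univ_three, mul_assoc]
  have hκ : ∀ i : Fin [(c₀, m₀), (c₁, m₁)].length, i = ⟨0, by simp⟩ ∨ i = ⟨1, by simp⟩ := by
    rintro ⟨i, hi⟩
    have : i < 2 := by simpa using hi
    interval_cases i
    · left; rfl
    · right; rfl
  obtain ⟨C, hC, h⟩ := kAny_allBut_odd_of_BT hBT
    (⟨![pc, rc₁, rc₂, rc₃], ![![false, a, b, c], ![false, false, r12, r13], ![false, false, false, r23],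
      ![false, false, false, false]]⟩ : SymbData 4) [(c₀, m₀), (c₁, m₁)] hpf (by simp) (by
      intro i j hij
      rcases hκ i with rfl | rfl <;> rcases hκ j with rfl | rfl
      · exact absurd rfl hij
      · rcases hdist with h | h | h | h | h
        · exact Or.inl h
        · exact Or.inr ⟨0, h⟩
        · exact Or.inr ⟨1, h⟩
        · exact Or.inr ⟨2, h⟩
        · exact Or.inr ⟨3, h⟩
      · rcases hdist with h | h | h | h | h
        · exact Or.inl fun hh => h hh.symm
        · exact Or.inr ⟨0, fun hh => h hh.symm⟩
        · exact Or.inr ⟨1, fun hh => h hh.symm⟩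
        · exact Or.inr ⟨2, fun hh => h hh.symm⟩
        · exact Or.inr ⟨3, fun hh => h hh.symm⟩
      · exact absurd rfl hij)
    ![r₁, r₂, r₃] hr (by
      intro j; fin_cases j
      · simpa using hr₁m
      · simpa using hr₂m
      · simpa using hr₃m) hrinj (by
      intro i j hij
      fin_cases i <;> fin_cases j
      · exact absurd hij (lt_irrefl _)
      · simpa using hr12
      · simpa using hr13
      · exact absurd hij (by decide)
      · exact absurd hij (lt_irrefl _)
      · simpa using hr23
      · exact absurd hij (by decide)
      · exact absurd hij (by decide)
      · exact absurd hij (lt_irrefl _))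
    hM (fun i => if i.val = 0 then κ₀ else κ₁) (by
      intro i; rcases hκ i with rfl | rfl
      · simpa using hκ₀u
      · simpa using hκ₁u)
    (by
      intro i; rcases hκ i with rfl | rfl
      · simpa using hκ₀m
      · simpa using hκ₁m)
    (by
      intro i q hq hqκ j
      rcases hκ i with rfl | rfl
      · have hh := hκ₀e q hq (by simpa using hqκ)
        fin_cases j
        · have hh1 := hh.1; rw [← hb₀₁] at hh1; simpa using hh1
        · have hh2 := hh.2.1; rw [← hb₀₂] at hh2; simpa using hh2
        · have hh3 := hh.2.2; rw [← hb₀₃] at hh3; simpa using hh3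
      · have hh := hκ₁e q hq (by simpa using hqκ)
        fin_cases j
        · have hh1 := hh.1; rw [← hb₁₁] at hh1; simpa using hh1
        · have hh2 := hh.2.1; rw [← hb₁₂] at hh2; simpa using hh2
        · have hh3 := hh.2.2; rw [← hb₁₃] at hh3; simpa using hh3)
  refine ⟨C, hC, fun Q hQ => ?_⟩
  obtain ⟨E, hE, hp⟩ := h Q hQ
  refine ⟨E, hE, fun p hp' hp8 ha hb hc hyp hpQ hpE => ?_⟩
  rw [← hprod p]
  exact hp p hp' (by simpa using hp8) (by
    intro j; fin_cases j
    · simpa using ha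
    · simpa using hb
    · simpa using hc) hyp hpQ hpE

/-! ## Assembly of the eight sign patterns -/

open scoped Classical in
/-- **Assembly of the eight sub-configurations `([(r₁/p) = −1], [(r₂/p) = −1], [(r₃/p) = −1])`** of a four-prime base: eight
censuses give one census for every prime `p` of the class (`r₁, r₂, r₃` excepted). [folklore] -/
theorem assemble_eight {R : ℕ → Prop} {r₁ r₂ r₃ pc8 : ℕ} (hr₁ : r₁.Prime) (hr₂ : r₂.Prime) (hr₃ : r₃.Prime)
    (h : ∀ a b c : Bool, ∃ C : ℝ, 0 < C ∧ ∀ Q : ℕ, 3 ≤ Q → ∃ E : Finset ℕ, (E.card : ℝ) ≤ C * Real.log Q ^ 8 ∧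
      ∀ p : ℕ, p.Prime → p % 8 = pc8 → (jacobiSym (r₁ : ℤ) p = -1 ↔ a = true) → (jacobiSym (r₂ : ℤ) p = -1 ↔ b = true) →
        (jacobiSym (r₃ : ℤ) p = -1 ↔ c = true) → Nat.sqrt Q < p → p ≤ Q → p ∉ E → R p) :
    ∃ C : ℝ, 0 < C ∧ ∀ Q : ℕ, 3 ≤ Q → ∃ E : Finset ℕ, (E.card : ℝ) ≤ C * Real.log Q ^ 8 ∧
      ∀ p : ℕ, p.Prime → p % 8 = pc8 → Nat.sqrt Q < p → p ≤ Q → p ∉ E → R p := by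
  have step : ∀ c : Bool, ∃ C : ℝ, 0 < C ∧ ∀ Q : ℕ, 3 ≤ Q → ∃ E : Finset ℕ, (E.card : ℝ) ≤ C * Real.log Q ^ 8 ∧
      ∀ p : ℕ, p.Prime → p % 8 = pc8 → Nat.sqrt Q < p → p ≤ Q → p ∉ E →
        ((jacobiSym (r₃ : ℤ) p = -1 ↔ c = true) → R p) := fun c =>
    assemble_four (R := fun p => (jacobiSym (r₃ : ℤ) p = -1 ↔ c = true) → R p) hr₁ hr₂ fun a b => by
      obtain ⟨C, hC, hh⟩ := h a b c
      refine ⟨C, hC, fun Q hQ => ?_⟩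
      obtain ⟨E, hE, hp⟩ := hh Q hQ
      exact ⟨E, hE, fun p hp' hp8 ha hb hyp hpQ hpE hc => hp p hp' hp8 ha hb hc hyp hpQ hpE⟩
  choose C hC hcfg using step
  have hlog8 : ∀ Q : ℕ, 3 ≤ Q → (1 : ℝ) ≤ Real.log Q ^ 8 := by
    intro Q hQ3
    have hQ3' : (3 : ℝ) ≤ Q := by exact_mod_cast hQ3
    have he : Real.exp 1 ≤ (Q : ℝ) := le_trans (le_of_lt (lt_trans Real.exp_one_lt_d9 (by norm_num))) hQ3'
    rw [← Real.log_le_log_iff (Real.exp_pos 1) (by linarith), Real.log_exp] at he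
    exact one_le_pow₀ he
  refine ⟨C false + C true + 1, by have := hC false; have := hC true; positivity, fun Q hQ => ?_⟩
  obtain ⟨E₁, hE₁, h₁⟩ := hcfg false Q hQ
  obtain ⟨E₂, hE₂, h₂⟩ := hcfg true Q hQ
  refine ⟨E₁ ∪ E₂ ∪ {r₃}, ?_, ?_⟩
  · have hu : ((E₁ ∪ E₂ ∪ {r₃}).card : ℝ) ≤ (E₁.card : ℝ) + E₂.card + 1 := by
      have a := Finset.card_union_le (E₁ ∪ E₂) {r₃}
      have b := Finset.card_union_le E₁ E₂
      rw [Finset.card_singleton] at a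
      exact_mod_cast a.trans (Nat.add_le_add_right b _)
    have hl := hlog8 Q hQ
    calc ((E₁ ∪ E₂ ∪ {r₃}).card : ℝ) ≤ (E₁.card : ℝ) + E₂.card + 1 := hu
      _ ≤ C false * Real.log Q ^ 8 + C true * Real.log Q ^ 8 + 1 * Real.log Q ^ 8 := by
          have := add_le_add hE₁ hE₂; linarith
      _ = (C false + C true + 1) * Real.log Q ^ 8 := by ring
  intro p hp hp8 hyp hpQ hpE
  simp only [Finset.mem_union, not_or, Finset.mem_singleton] at hpE
  obtain ⟨⟨hn₁, hn₂⟩, hne₃⟩ := hpE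
  have hc₃ : Int.gcd (r₃ : ℤ) p = 1 := by
    rw [Int.gcd_natCast_natCast]; exact (Nat.coprime_primes hr₃ hp).mpr (fun h => hne₃ h.symm)
  rcases jacobiSym.eq_one_or_neg_one hc₃ with h7 | h7
  · exact h₁ p hp hp8 hyp hpQ hn₁ (by rw [h7]; simp)
  · exact h₂ p hp hp8 hyp hpQ hn₂ (by rw [h7]; simp)

/-! ## `W = E_{105p}`, `p ≡ 7 (mod 8)` — the FIRST four-prime congruent family (k = 3) -/

open scoped Classical in
/-- ★ **`E_{105p}` (k = 3): the conclusion of crux 21381 for all but `O(log⁸ Q)` primes `p ≡ 7 (mod 8)`, modulo Burungale–Tian.**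
Base `(p, 3, 5, 7)` with `(5/3) = −1`, `(7/3) = +1`, `(7/5) = −1`; ONE pattern-free family for all eight sign patterns `((3/p),(5/p),(7/p))`
(criterion, `t = s*/2 + 1 = 2`, eight `decide`s): cells `(3 mod 8; (q/p) = (q/3) = (q/5) = +1, (q/7) = −1)` and
`(5 mod 8; (q/p) = (q/3) = −1, (q/5) = (q/7) = +1)`, unit slot classes `19, 29 (mod 840)`.
[cite: BurungaleTian2026, Thm. 1.1] [cite: Montgomery1978, p. 561] [cite: MontgomeryVaughan2007, Cor. 11.17] -/
theorem cruxConclusion_E105p_allBut_of_BT (hBT : burungaleTian_analyticRank_eq_zero_of_selmerCorank_eq_zero_of_hasCM) :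
    ∃ C : ℝ, 0 < C ∧ ∀ Q : ℕ, 3 ≤ Q → ∃ E : Finset ℕ, (E.card : ℝ) ≤ C * Real.log Q ^ 8 ∧
      ∀ p : ℕ, p.Prime → p % 8 = 7 → Nat.sqrt Q < p → p ≤ Q → p ∉ E →
        ∃ (K : Type) (_ : Field K) (_ : NumberField K),
          IsImaginaryQuadratic K ∧ 4 < (NumberField.discr K).natAbs ∧
          SatisfiesHeegnerHypothesis ((congruentNumberCurve (105 * p)).conductorNorm ℤ) K ∧
          ((congruentNumberCurve (105 * p)).quadraticTwist (NumberField.discr K : ℚ)).entireLFunction 1 ≠ 0 ∧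
          ¬ p ∣ NumberField.classNumber K := by
  have e : ∀ p : ℕ, p * (3 * 5 * 7) = 105 * p := fun p => by ring
  have u : ∀ n : ℕ, Nat.Coprime n 840 → IsUnit ((n : ℕ) : ZMod (8 * (3 * 5 * 7))) := fun n hn =>
    (ZMod.isUnit_iff_coprime n (8 * (3 * 5 * 7))).mpr hn
  have sl : ∀ {q κ : ℕ}, q % (8 * (3 * 5 * 7)) = κ % (8 * (3 * 5 * 7)) →
      jacobiSym (q : ℤ) 3 = jacobiSym ((κ % 3 : ℕ) : ℤ) 3 ∧ jacobiSym (q : ℤ) 5 = jacobiSym ((κ % 5 : ℕ) : ℤ) 5 ∧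
        jacobiSym (q : ℤ) 7 = jacobiSym ((κ % 7 : ℕ) : ℤ) 7 :=
    fun hq => ⟨jacobiSym_three_of_mod (mod_eq_of_mod_eq_of_dvd (by norm_num) hq),
      jacobiSym_five_of_mod (mod_eq_of_mod_eq_of_dvd (by norm_num) hq),
      jacobiSym_seven_of_mod (mod_eq_of_mod_eq_of_dvd (by norm_num) hq)⟩
  have h7 : Nat.Prime 7 := by norm_num
  refine assemble_eight (R := fun p => ∃ (K : Type) (_ : Field K) (_ : NumberField K),
      IsImaginaryQuadratic K ∧ 4 < (NumberField.discr K).natAbs ∧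
      SatisfiesHeegnerHypothesis ((congruentNumberCurve (105 * p)).conductorNorm ℤ) K ∧
      ((congruentNumberCurve (105 * p)).quadraticTwist (NumberField.discr K : ℚ)).entireLFunction 1 ≠ 0 ∧
      ¬ p ∣ NumberField.classNumber K) Nat.prime_three Nat.prime_five h7 fun a b c => ?_
  simp only [← e]
  refine kThree_allBut_two_of_BT hBT 3 1 2 3 true false true a b c 1 2 8 3 (by cases a <;> cases b <;> cases c <;> decide)
    (by decide) Nat.prime_three Nat.prime_five h7 (by norm_num) (by norm_num) (by norm_num) rfl rfl rfl (by norm_num)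
    (by norm_num) (by norm_num) 19 29 (u 19 (by norm_num)) (u 29 (by norm_num)) rfl rfl false false true true false false
    (by decide) (by decide) (by decide) (by decide) (by decide) (by decide) (fun q _ hq => ?_) (fun q _ hq => ?_)
  · obtain ⟨h3, h5, h7'⟩ := sl hq; rw [h3, h5, h7']; norm_num
  · obtain ⟨h3, h5, h7'⟩ := sl hq; rw [h3, h5, h7']; norm_num

end Summit.BirchSwinnertonDyer.BirchSwinnertonDyer.Theorems.LinnikCensus
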